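/-
Origin: expansion seat `prover-pub-hodgecm-mc-sinst-1-g9-0`, handover #1236 2026-08-20T20:38Z md5 a5b78762a241 (203 l.; NEW additive leaf, ns HodgeCM.Model.ThetaSpace; imports PKG #1234 Model/WeightFormsHecke + PKG Model/ThetaSpaceSatRightTranslate only; `rightShift`, `adelicThetaSpan P ιinf κ₁ τ₁ 𝓕` (span of the adèlic theta forms of all strict situations), `left_inv_of_mem_adelicThetaSpan`, `rightShift_mem_adelicThetaSpan` (stable under right translation by centralisers of ιinf G₁), `adelicThetaRep Gf hGf 𝓕 : Representation ℂ Gf (adelicThetaSpan …)`, dictionary `exists_mem_adelicThetaSpan_coe_eq_comp`, `heckeWFun_comp_eq_sum_rightShift_comp`, `exists_mem_adelicThetaSpan_heckeWFun_comp_eq`; NAME LIST: HodgeCM.Model.ThetaSpace.rightShift_mem_adelicThetaSpan · HodgeCM.Model.ThetaSpace.exists_mem_adelicThetaSpan_coe_eq_comp · HodgeCM.Model.ThetaSpace.heckeWFun_comp_eq_sum_rightShift_comp) (`HOME/mc/pub-hodgecm-mc-sinst-1-g9/stage/HodgeCM/Model/AdelicThetaModule.lean`, md5 a5b78762a241, 203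 lines);
landed by the gen-26 packager (p-g26) in gate run 63 as `HodgeCM/Model/AdelicThetaModule.lean` (verbatim).
-/
/-
Copyright (c) 2026 the pub-hodgecm formalisation cell (harness21).  New file, not vendored.
Origin: session prover-pub-hodgecm-mc-sinst-1-g8-0 (unit pub-hodgecm-mc-sinst-1-g8, S-INSTANCE CONSTRUCTOR gen 8; section/adelic side of the
(J-Liu-Θ) junction behind E's row 9 `hΘ` — the OFFER of STATUS 2026-08-20T19:19:51Z to axioms-1's (J3) design), 2026-08-20.
Intended final place: `HodgeCM/Model/AdelicThetaModule.lean` (NEW additive model-layer leaf, abstract over `P : WeilPairData`; imports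
`HodgeCM.Model.WeightFormsHecke` (#1234) and theta-3's `HodgeCM.Model.ThetaSpaceSatRightTranslate` only; nothing imports it; drop alone on bounce).
-/
import Summits.HodgeConjecture.HodgeCM.Model.WeightFormsHecke
import Summits.HodgeConjecture.HodgeCM.Model.ThetaSpaceSatRightTranslate

set_option autoImplicit false

/-!
# The adèlic theta module of the pair: a tower-shaped carrier, and the classical Hecke operators on it

For pair data `P : WeilPairData K L J GU` and archimedean data `(ιinf, κ₁, τ₁)`:
* `rightShift h : (GU → W) →ₗ[ℂ] (GU → W)`, `(R_h F) g = F (g h)` (`rightShift_mul`: `R_{hh'} = R_h ∘ R_{h'}`);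
* **`adelicThetaSpan P ιinf κ₁ τ₁ 𝓕 : Submodule ℂ (GU → W)`** — the span, inside the `W`-valued functions on `G_U(𝔸)`, of the adèlic theta forms
  (weight functions in `𝓕`) of ALL strict `K`-type situations of the pair (every level: situations read at level `⊥`, `KTypeSituation.ofLE`);
  `thetaForms_map_subtype_le_adelicThetaSpan` (each situation's theta forms lie in it), `left_inv_of_mem_adelicThetaSpan` (left `Γ_U`-invariance);
* **`rightShift_mem_adelicThetaSpan`** — it is STABLE under `R_h` for every `h` centralising `ιinf (G₁)` (a finite-adèlic element): theta-3's
  right-translated situation `KTypeSituation.rightTranslateStrict` at level `⊥` (`R_h θ_φ = θ_{ω(h)φ}`, tree `rightTranslateHom_thetaForm`);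
  hence **`adelicThetaRep Gf hGf 𝓕 : Representation ℂ Gf (adelicThetaSpan …)`** for any subgroup `Gf` centralising `ιinf (G₁)` — the
  `ℂ[G(𝔸_f)]`-module structure that [Liu21]'s `⊗' ω(μ_v, ε_v, χ_v)` statements are about (carrier only; nothing of Liu is claimed here);
* DICTIONARY to the classical side: `exists_mem_adelicThetaSpan_coe_eq_comp` — every element of the `KΓ`-saturated classical theta space of
  level `Δ` (`thetaSpaceSatOf`, theta-3) is the restriction `F ∘ ιinf` of an element of the adèlic theta module; and
  **`heckeWFun_comp_eq_sum_rightShift_comp`** / **`sum_rightShift_mem_adelicThetaSpan`** — the classical Hecke operator `T_g` (#1234 `heckeWFun`)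
  on such a restriction is the restriction of `Σ_q R_{(k q)⁻¹} F`, an element of the adèlic theta module (the correctors `k q` of the representatives
  `g (out q)⁻¹`, #1234 `exists_corrector_mul_inv`): the classical `T_g` on theta forms IS the group-algebra element `Σ_q [(k q)⁻¹]` of `ℂ[Gf]` acting
  on the tower — NO fixed-level hypothesis (hQ) involved.
KERNEL only: 0 records, 0 `def … : Prop`, nothing cited as a fact, 0 proof holes; `#print axioms` ⊆ {propext, Classical.choice, Quot.sound}.
-/

noncomputable section

open MeasureTheory NumberField.mixedEmbedding IsDedekindDomain
open Literature.NumberTheory.Automorphic Literature.NumberTheory.Weil1964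
open Literature.NumberTheory.Automorphic.WeightForms (restrictHom restrictHom_apply IsLevelCorrected IsWeightMatched)
open HodgeCM.PerL34.Seesaw HodgeCM.PerL34.RationalCoset HodgeCM.PerL34.SupplyAdelic
open HodgeCM.Model.SupplyInstance HodgeCM.Model.SupplyResidual
open HodgeCM.BallFormsHecke (heckeStab)
open HodgeCM.WeightFormsHecke (heckeWFun heckeWFun_apply heckeWFun_comp_apply)

namespace HodgeCM
namespace Model
namespace ThetaSpace

section Adelic

variable {K L : Type} [Field K] [NumberField K] [Field L] [NumberField L] [Algebra K L] [FiniteDimensional K L]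
variable {J : Type} [Fintype J] {GU : Type} [Group GU] [TopologicalSpace GU] [IsTopologicalGroup GU]
  [LocallyCompactSpace GU]
variable {P : WeilPairData K L J GU} [CompactSpace (GU ⧸ P.ΓU)]
variable {G₁ K₁ W : Type} [Group G₁] [Group K₁] [AddCommGroup W] [Module ℂ W]
variable {ιinf : G₁ →* GU} {Δ : Subgroup G₁} {κ₁ : K₁ →* G₁} {τ₁ : Representation ℂ K₁ W}

/-! ### Right translation on `W`-valued functions on `G_U(𝔸)` -/

omit [TopologicalSpace GU] [IsTopologicalGroup GU] [LocallyCompactSpace GU] in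
/-- **Right translation** `(R_h F) g = F (g h)` as a `ℂ`-linear endomorphism of `GU → W`. [folklore] -/
def rightShift (h : GU) : (GU → W) →ₗ[ℂ] (GU → W) where
  toFun F := fun g => F (g * h)
  map_add' _ _ := rfl
  map_smul' _ _ := rfl

omit [TopologicalSpace GU] [IsTopologicalGroup GU] [LocallyCompactSpace GU] in
/-- (Ported verbatim from the HodgeCMPerL package; no docstring in the source.) -/
@[simp] theorem rightShift_apply (h : GU) (F : GU → W) (g : GU) : rightShift (W := W) h F g = F (g * h) := rfl

omit [TopologicalSpace GU] [IsTopologicalGroup GU] [LocallyCompactSpace GU] in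
/-- `R_1 = id`. [folklore] -/
theorem rightShift_one : rightShift (W := W) (1 : GU) = LinearMap.id := by
  ext F g; simp

omit [TopologicalSpace GU] [IsTopologicalGroup GU] [LocallyCompactSpace GU] in
/-- `R_{h h'} = R_h ∘ R_{h'}` (with this convention `h ↦ R_h` is a homomorphism). [folklore] -/
theorem rightShift_mul (h h' : GU) : rightShift (W := W) (h * h') = rightShift h ∘ₗ rightShift h' := by
  ext F g; simp [mul_assoc]

/-! ### The adèlic theta module -/

variable [Module.IsReflexive ℂ W]

variable (P ιinf κ₁ τ₁) in
/-- **The adèlic theta module of the pair** (weight functions in `𝓕`, archimedean data `(ιinf, κ₁, τ₁)`): the span, in `GU → W`, of the adèlic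
theta forms of ALL strict `K`-type situations (every level — a situation of level `Δ` is read at level `⊥`). -/
def adelicThetaSpan (𝓕 : Set C(NumberField.relNormOneIdeles K L ⧸ NumberField.relNormOneRat K L, ℂ)) : Submodule ℂ (GU → W) :=
  ⨆ S : {S : KTypeSituation P ιinf (⊥ : Subgroup G₁) κ₁ τ₁ // S.IsStrict},
    (S.1.thetaForms 𝓕).map (weightForms P.ΓU S.1.κ S.1.τ).subtype

variable {𝓕 : Set C(NumberField.relNormOneIdeles K L ⧸ NumberField.relNormOneRat K L, ℂ)}

/-- Each strict situation's theta forms (any level) lie in the adèlic theta module. -/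
theorem thetaForms_map_subtype_le_adelicThetaSpan (S : KTypeSituation P ιinf Δ κ₁ τ₁) (hS : S.IsStrict) :
    (S.thetaForms 𝓕).map (weightForms P.ΓU S.κ S.τ).subtype ≤ adelicThetaSpan P ιinf κ₁ τ₁ 𝓕 :=
  le_iSup_of_le ⟨S.ofLE bot_le, hS.ofLE bot_le⟩ le_rfl

/-- A single theta form lies in the adèlic theta module. -/
theorem coe_mem_adelicThetaSpan (S : KTypeSituation P ιinf Δ κ₁ τ₁) (hS : S.IsStrict) {θ : weightForms P.ΓU S.κ S.τ}
    (hθ : θ ∈ S.thetaForms 𝓕) : (θ : GU → W) ∈ adelicThetaSpan P ιinf κ₁ τ₁ 𝓕 :=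
  thetaForms_map_subtype_le_adelicThetaSpan S hS ⟨θ, hθ, rfl⟩

/-- Elements of the adèlic theta module are left-`Γ_U`-invariant. -/
theorem left_inv_of_mem_adelicThetaSpan {F : GU → W} (hF : F ∈ adelicThetaSpan P ιinf κ₁ τ₁ 𝓕) :
    ∀ γ ∈ P.ΓU, ∀ g : GU, F (γ * g) = F g := by
  refine Submodule.iSup_induction _ (motive := fun F => ∀ γ ∈ P.ΓU, ∀ g : GU, F (γ * g) = F g) hF ?_ ?_ ?_
  · rintro S F ⟨θ, -, rfl⟩ γ hγ g
    exact θ.2.1 γ hγ g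
  · intro γ _ g; rfl
  · intro F F' hF hF' γ hγ g
    simp only [Pi.add_apply, hF γ hγ g, hF' γ hγ g]

/-- **The adèlic theta module is stable under right translation by every element centralising `ιinf (G₁)`** (theta-3's right-translated
situation at level `⊥`: `R_h θ_φ = θ_{ω(h)φ}`). -/
theorem rightShift_mem_adelicThetaSpan {h : GU} (hh : ∀ x : G₁, Commute h (ιinf x)) {F : GU → W}
    (hF : F ∈ adelicThetaSpan P ιinf κ₁ τ₁ 𝓕) : rightShift h F ∈ adelicThetaSpan P ιinf κ₁ τ₁ 𝓕 := by
  refine Submodule.iSup_induction _ (motive := fun F => rightShift h F ∈ adelicThetaSpan P ιinf κ₁ τ₁ 𝓕) hF ?_ ?_ ?_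
  · rintro ⟨S, hS⟩ F ⟨θ, hθ, rfl⟩
    have hK : ∀ a ∈ (⊥ : Subgroup GU), h⁻¹ * a * h ∈ (⊥ : Subgroup GU) := fun a ha => by
      rw [(Subgroup.mem_bot).1 ha, mul_one, inv_mul_cancel]; exact Subgroup.one_mem _
    have hcorr : ∀ δ ∈ (⊥ : Subgroup G₁), ∃ x ∈ (⊥ : Subgroup GU), ιinf δ * x ∈ P.ΓU ∧ ∀ y : G₁, Commute x (ιinf y) :=
      fun δ hδ => ⟨1, Subgroup.one_mem _, by rw [(Subgroup.mem_bot).1 hδ, map_one, mul_one]; exact P.ΓU.one_mem,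
        fun y => Commute.one_left _⟩
    obtain ⟨θ', hθ', hcoe⟩ :=
      S.exists_mem_thetaForms_coe_eq_rightTranslate hh (S.isSaturated_bot) hK hcorr 𝓕 hθ
    have hS' := hS.rightTranslateStrict hh (S.isSaturated_bot) hK hcorr
    have : rightShift h ((weightForms P.ΓU S.κ S.τ).subtype θ) = (θ'.1 : GU → W) := by
      rw [hcoe]; rfl
    rw [this]
    exact coe_mem_adelicThetaSpan _ hS' hθ'
  · rw [map_zero]; exact Submodule.zero_mem _
  · intro F F' hF hF'
    rw [map_add]; exact Submodule.add_mem _ hF hF'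

/-- Finite sums of right translates stay in the module. -/
theorem sum_rightShift_mem_adelicThetaSpan {Q : Type} [Fintype Q] (k : Q → GU) (hk : ∀ q (x : G₁), Commute (k q) (ιinf x))
    {F : GU → W} (hF : F ∈ adelicThetaSpan P ιinf κ₁ τ₁ 𝓕) :
    ∑ q, rightShift (k q)⁻¹ F ∈ adelicThetaSpan P ιinf κ₁ τ₁ 𝓕 :=
  Submodule.sum_mem _ fun q _ => rightShift_mem_adelicThetaSpan (fun x => (hk q x).inv_left) hF

/-- **The representation of a finite-adèlic part on the adèlic theta module**: for a subgroup `Gf ≤ G_U(𝔸)` centralising `ιinf (G₁)`,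
`h ↦ R_h` restricted to `adelicThetaSpan`. -/
def adelicThetaRep (Gf : Subgroup GU) (hGf : ∀ h ∈ Gf, ∀ x : G₁, Commute h (ιinf x))
    (𝓕 : Set C(NumberField.relNormOneIdeles K L ⧸ NumberField.relNormOneRat K L, ℂ)) :
    Representation ℂ Gf (adelicThetaSpan P ιinf κ₁ τ₁ 𝓕) where
  toFun h := (rightShift (h : GU)).restrict fun F hF => rightShift_mem_adelicThetaSpan (hGf h h.2) hF
  map_one' := by
    apply LinearMap.ext; intro F; apply Subtype.ext; funext g
    simp [LinearMap.restrict_apply]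
  map_mul' h h' := by
    apply LinearMap.ext; intro F; apply Subtype.ext; funext g
    simp [LinearMap.restrict_apply, mul_assoc]

/-- (Ported verbatim from the HodgeCMPerL package; no docstring in the source.) -/
@[simp] theorem coe_adelicThetaRep_apply (Gf : Subgroup GU) (hGf : ∀ h ∈ Gf, ∀ x : G₁, Commute h (ιinf x))
    (h : Gf) (F : adelicThetaSpan P ιinf κ₁ τ₁ 𝓕) (g : GU) :
    (adelicThetaRep Gf hGf 𝓕 h F : GU → W) g = (F : GU → W) (g * h) := rfl

/-! ### Dictionary with the classical theta spaces and the classical Hecke operators -/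

/-- **Every element of the `KΓ`-saturated classical theta space of level `Δ` is the archimedean restriction of an element of the adèlic
theta module.** -/
theorem exists_mem_adelicThetaSpan_coe_eq_comp {KΓ : Subgroup GU} {f : weightForms Δ κ₁ τ₁}
    (hf : f ∈ thetaSpaceSatOf P ιinf Δ κ₁ τ₁ KΓ 𝓕) :
    ∃ F ∈ adelicThetaSpan P ιinf κ₁ τ₁ 𝓕, (f : G₁ → W) = F ∘ ιinf := by
  refine Submodule.iSup_induction _
    (motive := fun f : weightForms Δ κ₁ τ₁ => ∃ F ∈ adelicThetaSpan P ιinf κ₁ τ₁ 𝓕, (f : G₁ → W) = F ∘ ιinf) hf ?_ ?_ ?_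
  · rintro ⟨S, hsat, hstr⟩ f ⟨θ, hθ, rfl⟩
    exact ⟨θ, coe_mem_adelicThetaSpan S hstr hθ, rfl⟩
  · exact ⟨0, Submodule.zero_mem _, rfl⟩
  · rintro f f' ⟨F, hF, hfe⟩ ⟨F', hF', hfe'⟩
    refine ⟨F + F', Submodule.add_mem _ hF hF', ?_⟩
    rw [Submodule.coe_add, hfe, hfe']; rfl

omit [IsTopologicalGroup GU] [LocallyCompactSpace GU] [CompactSpace (GU ⧸ P.ΓU)] [Module.IsReflexive ℂ W] in
/-- **The classical Hecke operator on a restriction is the restriction of a sum of right translates**: for `F` left-`Γ_U`-invariant and correctors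
`k q` of the representatives `g (out q)⁻¹` (`ιinf (g (out q)⁻¹) · k q ∈ Γ_U`, `k q` centralising `ιinf (G₁)`),
`T_g (F ∘ ιinf) = (Σ_q R_{(k q)⁻¹} F) ∘ ιinf` (#1234 `heckeWFun_comp_apply`, packaged as functions). -/
theorem heckeWFun_comp_eq_sum_rightShift_comp {g : G₁} [Fintype (Δ ⧸ (heckeStab Δ g).subgroupOf Δ)] {F : GU → W}
    (hF : ∀ γ ∈ P.ΓU, ∀ y, F (γ * y) = F y) (k : Δ ⧸ (heckeStab Δ g).subgroupOf Δ → GU)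
    (hk : ∀ q : Δ ⧸ (heckeStab Δ g).subgroupOf Δ, ιinf (g * (((Quotient.out q : Δ) : G₁))⁻¹) * k q ∈ P.ΓU)
    (hkc : ∀ q (x : G₁), Commute (k q) (ιinf x)) :
    heckeWFun Δ g (F ∘ ιinf) = (∑ q, rightShift (k q)⁻¹ F) ∘ ιinf := by
  funext x
  rw [heckeWFun_comp_apply ιinf hF k hk hkc x, Function.comp_apply, Finset.sum_apply]
  rfl

/-- **The classical Hecke operators act on restricted theta forms through the adèlic theta module**: for `F` in the module and correctors as
above, `T_g (F ∘ ιinf) = F' ∘ ιinf` with `F' = Σ_q R_{(k q)⁻¹} F` again in the module — the classical `T_g` is the group-algebra element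
`Σ_q [(k q)⁻¹]` of the finite-adèlic part acting on the tower (no fixed-level hypothesis). -/
theorem exists_mem_adelicThetaSpan_heckeWFun_comp_eq {g : G₁} [Fintype (Δ ⧸ (heckeStab Δ g).subgroupOf Δ)] {F : GU → W}
    (hF : F ∈ adelicThetaSpan P ιinf κ₁ τ₁ 𝓕) (k : Δ ⧸ (heckeStab Δ g).subgroupOf Δ → GU)
    (hk : ∀ q : Δ ⧸ (heckeStab Δ g).subgroupOf Δ, ιinf (g * (((Quotient.out q : Δ) : G₁))⁻¹) * k q ∈ P.ΓU)
    (hkc : ∀ q (x : G₁), Commute (k q) (ιinf x)) :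
    ∃ F' ∈ adelicThetaSpan P ιinf κ₁ τ₁ 𝓕, heckeWFun Δ g (F ∘ ιinf) = F' ∘ ιinf :=
  ⟨∑ q, rightShift (k q)⁻¹ F, sum_rightShift_mem_adelicThetaSpan k hkc hF,
    heckeWFun_comp_eq_sum_rightShift_comp (left_inv_of_mem_adelicThetaSpan hF) k hk hkc⟩

end Adelic

end ThetaSpace
end Model
end HodgeCM

end
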